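import Mathlib
import Summits.NavierStokesRegularity.NavierStokesRegularity.Theorems.EulerZoomLiouvillePowerGaugeEulerLiouvilleSelfSimilarPressureParking
import Summits.NavierStokesRegularity.NavierStokesRegularity.Theorems.EulerZoomLiouvillePowerGaugeEulerLiouvilleSelfSimilarBernoulliSqueezePressureThinTools
import HarnessLib

/-!
# «FAR PRESSURISED POINTS OF A CLASS PROFILE SIT NEXT TO GRADIENT SPIKES» — the average side of the pressure-excess lever
# (crux `EulerZoomLiouville.PowerGaugeEulerLiouville` = stmt-NavierStokesRegularity-19832, THE ONE STATEMENT; LEAD ns-typeII-p2 g12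
# RESIDUE-MEMO-19832-g12 §4 (A2) / §5 / T2, width seat ns-ezl-w1 g4)

Route №10 `EulerZoomLiouville` (NavierStokesRegularity).  Sequel of `…SelfSimilarPressureParking` (this seat): there, a point `x₀ ∈ B̄_L`
whose pressure EXCEEDS its `probeBump R`-average by `κL²` was shown to sit within `≲ c_E L^{−1−ρ}/κ` of a gradient spike
`‖DV‖ ≳ κ^{3/2}L^{2+ρ}/c_E` (`PressureParking.exists_gradient_spike_near_pressure_excess`).  Here the AVERAGE is controlled from the
class data alone, so the excess hypothesis becomes the plain pressure level `P′(x₀) ≥ 3κL²`: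

* `integral_probeBump_mul_comp_add_le` — for a continuous `η`, a level `h ≥ 0` and `R > 0`:
  `∫ χ_R(y) η(x₀+y) dy ≤ h + (m R³)⁻¹ ∫_{B_{2R}(x₀) ∩ {η > h}} η` (`χ_R ≤ (mR³)⁻¹`, unit mass);
* `setIntegral_le_of_weight` — Hölder `(3/2, 3)` against the `D`-weight: for `A ⊆ B_{5L}(0)` measurable with `η ≥ 0` on `A`,
  `∫_A η ≤ (C_D (5L)^{2−2ρ})^{2/3} vol(A)^{1/3}` whenever `∫ |η|^{3/2} ‖y‖^{2ρ−2} ≤ C_D` (`ρ < 1`);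
* **`integral_probeBump_pressure_le`** — CLASS AVERAGE BOUND: for a self-similar Euler profile `(V, P′)` on `ℝ³` whose classical
  pressure carries the weighted `D`-datum `∫ |P′|^{3/2}‖y‖^{2ρ−2} ≤ C_D` (`ρ < 1`) and every `κ > 0` there are `C ≥ 0`, `L₁ ≥ 1` with
  `∫ χ_R(y) P′(x₀+y) dy ≤ κL² + C L^{1−2ρ}/R³` for all `L ≥ L₁`, `‖x₀‖ ≤ L`, `0 < R ≤ L` — the PRIOR Chebyshev thinness of the
  pressurised set (`Loc.volume_pressureHigh_inter_ball_le_prior`, rate `1+2ρ`, growth-free) and Hölder; exponent bookkeeping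
  `(2(2−2ρ) + (−1−2ρ))/3 = 1 − 2ρ`;
* **`exists_gradient_spike_near_pressurised_point`** — THE PORTRAIT THEOREM: with, in addition, the `E`-gauge growth
  `∫_{B_L(0)}‖DV‖² ≤ c_E L^{1−ρ}` (`0 ≤ ρ < 1`), for every `κ > 0` there is `L₁` such that for all `L ≥ L₁` and all `x₀ ∈ B̄_L(0)` with
  `P′(x₀) ≥ 3κL²` some `z` with `‖z − x₀‖ ≤ 2δ_L`, `δ_L := (12 c_E (3L)^{1−ρ} + 1)/(m κ L²) ≍ c_E L^{−1−ρ}/κ`, has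
  `‖DV(z)‖² ≥ m κ L²/(48 v₁ δ_L²) ≍ κ³ L^{4+2ρ}/c_E²` — EVERY FAR PRESSURISED POINT OF A CLASS PROFILE IS PINNED TO A GRADIENT SPIKE OF
  HEIGHT `L^{2+ρ}` WITHIN `L^{−1−ρ}` (take `R = L`: the average is `≤ 2κL²` for large `L`).

Portrait reading for THE ONE STATEMENT (memo §1 (N2)/(N3), §4 (A2)): the `E`-gauge lets a spike of height `L^{2+ρ}` occupy a ball
of radius at most `L^{−1−ρ}` — so the pressurised far field of a needle is a field of `C¹`-LAYERS of thickness `L^{−1−ρ}` across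
which `V` varies by `O(L)`; nothing here excludes them.

HONEST LABEL: portrait stratum / tool.  WHAT THIS IS NOT: not NS, not E — `--supports` stmt-19832 on the MODEL lattice; 19832 OPEN;
NS regularity NOT proved. [folklore; GilbargTrudinger2001 Thm 2.1; ConstantinIgnatovaVicol2026Putative §3.1.1 (3.3)]
-/

noncomputable section

-- flat `Theorems/<Route><Decl>…` files of one crux share the namespace of the crux (tree convention)
set_option linter.dupNamespace false

open MeasureTheory Set Filter Topology Metric Function InnerProductSpace
open scoped RealInnerProductSpace NNReal ENNReal Laplacian

namespace Summit.NavierStokesRegularity.NavierStokesRegularity.Theorems.PowerGaugeEulerLiouville.PressureParking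

open Literature.Analysis Literature.Analysis.FluidPDE
open Summit.NavierStokesRegularity.NavierStokesRegularity.Theorems.PowerGaugeEulerLiouville.BernoulliThinness

/-! ### The probe-bump average against a level -/

/-- Translation of an integral over a ball cut by a superlevel set: `∫_{B_r(0) ∩ {h < η(x₀+·)}} η(x₀ + z) dz = ∫_{B_r(x₀) ∩ {h < η}} η`.
[folklore] -/
theorem setIntegral_ball_inter_comp_add (η : EuclideanSpace ℝ (Fin 3) → ℝ) (x₀ : EuclideanSpace ℝ (Fin 3)) (r h : ℝ)
    (hη : Continuous η) :
    ∫ z in ball (0 : EuclideanSpace ℝ (Fin 3)) r ∩ {z | h < η (x₀ + z)}, η (x₀ + z) =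
      ∫ z in ball x₀ r ∩ {z | h < η z}, η z := by
  have hm0 : MeasurableSet (ball (0 : EuclideanSpace ℝ (Fin 3)) r ∩ {z | h < η (x₀ + z)}) :=
    measurableSet_ball.inter (isOpen_lt continuous_const (hη.comp (continuous_const.add continuous_id))).measurableSet
  have hm1 : MeasurableSet (ball x₀ r ∩ {z | h < η z}) :=
    measurableSet_ball.inter (isOpen_lt continuous_const hη).measurableSet
  rw [← integral_indicator hm0, ← integral_indicator hm1]
  have h : (ball (0 : EuclideanSpace ℝ (Fin 3)) r ∩ {z | h < η (x₀ + z)}).indicator (fun z => η (x₀ + z)) =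
      fun z => (ball x₀ r ∩ {z | h < η z}).indicator η (x₀ + z) := by
    funext z
    have hiff : z ∈ ball (0 : EuclideanSpace ℝ (Fin 3)) r ∩ {z | h < η (x₀ + z)} ↔
        x₀ + z ∈ ball x₀ r ∩ {z | h < η z} := by
      simp only [mem_inter_iff, mem_setOf_eq, mem_ball, dist_eq_norm, add_sub_cancel_left, sub_zero]
    by_cases hz : z ∈ ball (0 : EuclideanSpace ℝ (Fin 3)) r ∩ {z | h < η (x₀ + z)}
    · rw [indicator_of_mem hz, indicator_of_mem (hiff.1 hz)]
    · rw [indicator_of_notMem hz, indicator_of_notMem (fun h' => hz (hiff.2 h'))]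
  rw [h]
  exact integral_add_left_eq_self _ x₀

/-- **The probe-bump average against a level.**  For a continuous `η`, a level `h ≥ 0`, `R > 0` and any centre `x₀`:
`∫ χ_R(y) η(x₀ + y) dy ≤ h + (m R³)⁻¹ ∫_{B_{2R}(x₀) ∩ {η > h}} η` — `χ_R` has unit mass, is `≤ (m R³)⁻¹` and vanishes off `‖y‖ < 2R`, and
`χ_R (η − h) ≤ (mR³)⁻¹ η 𝟙_{η > h}` pointwise for `h ≥ 0`. [folklore] -/
theorem integral_probeBump_mul_comp_add_le {η : EuclideanSpace ℝ (Fin 3) → ℝ} (hη : Continuous η) {R : ℝ} (hR : 0 < R)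
    {h : ℝ} (hh : 0 ≤ h) (x₀ : EuclideanSpace ℝ (Fin 3)) :
    ∫ y, probeBump R y * η (x₀ + y) ≤
      h + (baseBumpMass (EuclideanSpace ℝ (Fin 3)) * R ^ 3)⁻¹ * ∫ z in ball x₀ (2 * R) ∩ {z | h < η z}, η z := by
  set M : ℝ := (baseBumpMass (EuclideanSpace ℝ (Fin 3)) * R ^ 3)⁻¹ with hMdef
  have hm : 0 < baseBumpMass (EuclideanSpace ℝ (Fin 3)) := baseBumpMass_pos
  have hM0 : 0 ≤ M := by positivity
  have hχc : Continuous (probeBump (E := EuclideanSpace ℝ (Fin 3)) R) := (contDiff_probeBump R (n := 0)).continuous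
  have hχM : ∀ y : EuclideanSpace ℝ (Fin 3), probeBump R y ≤ M := fun y => by
    have h1 := abs_probeBump_le hR y
    rw [finrank_euclideanSpace_fin] at h1
    exact (le_abs_self _).trans h1
  have hχ0 := probeBump_nonneg (E := EuclideanSpace ℝ (Fin 3)) hR
  have hχcs := hasCompactSupport_probeBump (E := EuclideanSpace ℝ (Fin 3)) hR
  set A₀ : Set (EuclideanSpace ℝ (Fin 3)) := ball (0 : EuclideanSpace ℝ (Fin 3)) (2 * R) ∩ {z | h < η (x₀ + z)} with hA₀
  have hηt : Continuous fun z : EuclideanSpace ℝ (Fin 3) => η (x₀ + z) := hη.comp (continuous_const.add continuous_id)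
  have hA₀m : MeasurableSet A₀ := measurableSet_ball.inter (isOpen_lt continuous_const hηt).measurableSet
  -- split off the level
  have hsplit : ∫ y, probeBump R y * η (x₀ + y) = h + ∫ y, probeBump R y * (η (x₀ + y) - h) := by
    have hi1 : Integrable fun y : EuclideanSpace ℝ (Fin 3) => probeBump R y * (η (x₀ + y) - h) :=
      (hχc.mul (hηt.sub continuous_const)).integrable_of_hasCompactSupport (hχcs.mul_right (f' := fun y => η (x₀ + y) - h))
    have hi2 : Integrable fun y : EuclideanSpace ℝ (Fin 3) => probeBump R y * h := (integrable_probeBump hR).mul_const h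
    have e : (fun y => probeBump R y * η (x₀ + y)) = fun y => probeBump R y * h + probeBump R y * (η (x₀ + y) - h) := by
      funext y; ring
    rw [e, integral_add hi2 hi1, integral_mul_const, integral_probeBump hR, one_mul]
  -- pointwise bound of the fluctuation
  have hpt : ∀ y, probeBump R y * (η (x₀ + y) - h) ≤ A₀.indicator (fun z => M * η (x₀ + z)) y := by
    intro y
    by_cases hy : y ∈ A₀
    · rw [indicator_of_mem hy]
      have hηy : h < η (x₀ + y) := hy.2
      have hη0 : 0 ≤ η (x₀ + y) := hh.trans hηy.le
      calc probeBump R y * (η (x₀ + y) - h) ≤ probeBump R y * η (x₀ + y) := by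
            nlinarith [hχ0 y]
        _ ≤ M * η (x₀ + y) := mul_le_mul_of_nonneg_right (hχM y) hη0
    · rw [indicator_of_notMem hy]
      by_cases hyb : ‖y‖ < 2 * R
      · have hηy : η (x₀ + y) ≤ h := by
          by_contra hlt
          exact hy ⟨mem_ball_zero_iff.2 hyb, not_le.1 hlt⟩
        nlinarith [hχ0 y]
      · rw [probeBump_eq_zero hR (not_lt.1 hyb), zero_mul]
  have hi1 : Integrable fun y : EuclideanSpace ℝ (Fin 3) => probeBump R y * (η (x₀ + y) - h) :=
    (hχc.mul (hηt.sub continuous_const)).integrable_of_hasCompactSupport (hχcs.mul_right (f' := fun y => η (x₀ + y) - h))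
  have hIA : IntegrableOn (fun z => M * η (x₀ + z)) A₀ :=
    ((continuous_const.mul hηt).continuousOn.integrableOn_compact
      (isCompact_closedBall (0 : EuclideanSpace ℝ (Fin 3)) (2 * R))).mono_set
      (inter_subset_left.trans ball_subset_closedBall)
  have hind : Integrable (A₀.indicator fun z => M * η (x₀ + z)) := hIA.integrable_indicator hA₀m
  have hle : ∫ y, probeBump R y * (η (x₀ + y) - h) ≤ M * ∫ z in ball x₀ (2 * R) ∩ {z | h < η z}, η z := by
    calc ∫ y, probeBump R y * (η (x₀ + y) - h) ≤ ∫ y, A₀.indicator (fun z => M * η (x₀ + z)) y :=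
          integral_mono hi1 hind hpt
      _ = M * ∫ z in ball x₀ (2 * R) ∩ {z | h < η z}, η z := by
          rw [integral_indicator hA₀m, integral_const_mul, hA₀, setIntegral_ball_inter_comp_add η x₀ (2 * R) h hη]
  rw [hsplit]
  linarith

/-! ### Hölder against the `D`-weight -/

/-- **Hölder `(3/2, 3)` against the weight `‖y‖^{2ρ−2}`.**  If `∫ |η|^{3/2} ‖y‖^{2ρ−2} ≤ C_D` (`ρ < 1`) and `A ⊆ B_{5L}(0)` is measurable
with `η ≥ 0` on `A`, then `∫_A η ≤ (C_D (5L)^{2−2ρ})^{2/3} · vol(A)^{1/3}` (on `B_{5L}` the weight is `≥ (5L)^{2ρ−2}`). [folklore] -/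
theorem setIntegral_le_of_weight {η : EuclideanSpace ℝ (Fin 3) → ℝ} (hη : Continuous η) {ρ CD : ℝ} (hρ1 : ρ < 1)
    (hCD : 0 ≤ CD)
    (hD : ∫⁻ y, ‖η y‖ₑ ^ (3 / 2 : ℝ) * ENNReal.ofReal (‖y‖ ^ (2 * ρ - 2)) ≤ ENNReal.ofReal CD)
    {A : Set (EuclideanSpace ℝ (Fin 3))} (hA : MeasurableSet A) {L : ℝ} (hL : 0 < L)
    (hAL : A ⊆ ball (0 : EuclideanSpace ℝ (Fin 3)) (5 * L)) (hη0 : ∀ z ∈ A, 0 ≤ η z) :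
    ∫ z in A, η z ≤ (CD * (5 * L) ^ (2 - 2 * ρ)) ^ (2 / 3 : ℝ) * (volume A).toReal ^ (1 / 3 : ℝ) := by
  have h5L : 0 < 5 * L := by positivity
  -- the weighted `L^{3/2}` mass on `A`
  have hw : ∀ y ∈ A, y ≠ 0 →
      ‖η y‖ₑ ^ (3 / 2 : ℝ) ≤ ENNReal.ofReal ((5 * L) ^ (2 - 2 * ρ)) * (‖η y‖ₑ ^ (3 / 2 : ℝ) * ENNReal.ofReal (‖y‖ ^ (2 * ρ - 2))) := by
    intro y hy hy0
    have hyn : 0 < ‖y‖ := norm_pos_iff.2 hy0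
    have hy5 : ‖y‖ < 5 * L := mem_ball_zero_iff.1 (hAL hy)
    have hge : 1 ≤ (5 * L) ^ (2 - 2 * ρ) * ‖y‖ ^ (2 * ρ - 2) := by
      have h1 : (5 * L) ^ (2 * ρ - 2) ≤ ‖y‖ ^ (2 * ρ - 2) :=
        Real.rpow_le_rpow_of_nonpos hyn hy5.le (by linarith)
      have h2 : (5 * L) ^ (2 - 2 * ρ) * (5 * L) ^ (2 * ρ - 2) = 1 := by
        rw [← Real.rpow_add h5L]; norm_num
      calc (1 : ℝ) = (5 * L) ^ (2 - 2 * ρ) * (5 * L) ^ (2 * ρ - 2) := h2.symm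
        _ ≤ (5 * L) ^ (2 - 2 * ρ) * ‖y‖ ^ (2 * ρ - 2) := mul_le_mul_of_nonneg_left h1 (by positivity)
    calc ‖η y‖ₑ ^ (3 / 2 : ℝ) = 1 * ‖η y‖ₑ ^ (3 / 2 : ℝ) := (one_mul _).symm
      _ ≤ ENNReal.ofReal ((5 * L) ^ (2 - 2 * ρ) * ‖y‖ ^ (2 * ρ - 2)) * ‖η y‖ₑ ^ (3 / 2 : ℝ) := by
          gcongr
          rw [← ENNReal.ofReal_one]
          exact ENNReal.ofReal_le_ofReal hge
      _ = ENNReal.ofReal ((5 * L) ^ (2 - 2 * ρ)) * (‖η y‖ₑ ^ (3 / 2 : ℝ) * ENNReal.ofReal (‖y‖ ^ (2 * ρ - 2))) := by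
          rw [ENNReal.ofReal_mul (by positivity)]; ring
  have hae0 : ∀ᵐ y ∂(volume.restrict A), y ≠ (0 : EuclideanSpace ℝ (Fin 3)) := by
    refine ae_restrict_of_ae ?_
    rw [ae_iff]
    simp
  have hmass : ∫⁻ y in A, ‖η y‖ₑ ^ (3 / 2 : ℝ) ≤ ENNReal.ofReal ((5 * L) ^ (2 - 2 * ρ)) * ENNReal.ofReal CD := by
    calc ∫⁻ y in A, ‖η y‖ₑ ^ (3 / 2 : ℝ)
        ≤ ∫⁻ y in A, ENNReal.ofReal ((5 * L) ^ (2 - 2 * ρ)) * (‖η y‖ₑ ^ (3 / 2 : ℝ) * ENNReal.ofReal (‖y‖ ^ (2 * ρ - 2))) := by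
          refine lintegral_mono_ae ?_
          filter_upwards [ae_restrict_mem hA, hae0] with y hy hy0
          exact hw y hy hy0
      _ = ENNReal.ofReal ((5 * L) ^ (2 - 2 * ρ)) * ∫⁻ y in A, ‖η y‖ₑ ^ (3 / 2 : ℝ) * ENNReal.ofReal (‖y‖ ^ (2 * ρ - 2)) := by
          rw [lintegral_const_mul' _ _ ENNReal.ofReal_ne_top]
      _ ≤ ENNReal.ofReal ((5 * L) ^ (2 - 2 * ρ)) * ENNReal.ofReal CD := by
          gcongr
          exact (lintegral_mono_set (subset_univ A) |>.trans (by rw [Measure.restrict_univ])).trans hD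
  -- Hölder on `A`
  have h32 : (3 / 2 : ℝ).HolderConjugate 3 := by rw [Real.holderConjugate_iff]; norm_num
  have hf : AEMeasurable (fun y => ‖η y‖ₑ) (volume.restrict A) := hη.aemeasurable.enorm.restrict
  have hH := ENNReal.lintegral_mul_le_Lp_mul_Lq (volume.restrict A) h32 hf (g := fun _ => 1) aemeasurable_const
  simp only [Pi.mul_apply, mul_one, ENNReal.one_rpow, lintegral_const, Measure.restrict_apply_univ, one_div,
    one_mul] at hH
  rw [show ((3 : ℝ) / 2)⁻¹ = 2 / 3 by norm_num, show (3 : ℝ)⁻¹ = 1 / 3 by norm_num] at hH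
  -- `∫_A η = (∫⁻_A ‖η‖ₑ).toReal`
  have hint : IntegrableOn η A :=
    (hη.continuousOn.integrableOn_compact (isCompact_closedBall (0 : EuclideanSpace ℝ (Fin 3)) (5 * L))).mono_set
      (hAL.trans ball_subset_closedBall)
  have hvolA : volume A < ⊤ := (measure_mono hAL).trans_lt measure_ball_lt_top
  have heq : ∫ z in A, η z = (∫⁻ z in A, ‖η z‖ₑ).toReal := by
    rw [integral_eq_lintegral_of_nonneg_ae ((ae_restrict_mem hA).mono fun z hz => hη0 z hz)
      hη.aestronglyMeasurable.restrict]
    congr 1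
    refine lintegral_congr_ae ((ae_restrict_mem hA).mono fun z hz => ?_)
    dsimp only
    rw [← ofReal_norm, Real.norm_of_nonneg (hη0 z hz)]
  rw [heq]
  have hfin : (∫⁻ y in A, ‖η y‖ₑ ^ (3 / 2 : ℝ)) ^ (2 / 3 : ℝ) * volume A ^ (1 / 3 : ℝ) ≠ ⊤ := by
    refine ENNReal.mul_ne_top ?_ ?_
    · exact ENNReal.rpow_ne_top_of_nonneg (by norm_num)
        (ne_top_of_le_ne_top (ENNReal.mul_ne_top ENNReal.ofReal_ne_top ENNReal.ofReal_ne_top) hmass)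
    · exact ENNReal.rpow_ne_top_of_nonneg (by norm_num) hvolA.ne
  calc (∫⁻ z in A, ‖η z‖ₑ).toReal
      ≤ ((∫⁻ y in A, ‖η y‖ₑ ^ (3 / 2 : ℝ)) ^ (2 / 3 : ℝ) * volume A ^ (1 / 3 : ℝ)).toReal :=
        ENNReal.toReal_mono hfin hH
    _ ≤ ((ENNReal.ofReal ((5 * L) ^ (2 - 2 * ρ)) * ENNReal.ofReal CD) ^ (2 / 3 : ℝ) * volume A ^ (1 / 3 : ℝ)).toReal := by
        refine ENNReal.toReal_mono ?_ ?_
        · exact ENNReal.mul_ne_top (ENNReal.rpow_ne_top_of_nonneg (by norm_num)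
            (ENNReal.mul_ne_top ENNReal.ofReal_ne_top ENNReal.ofReal_ne_top))
            (ENNReal.rpow_ne_top_of_nonneg (by norm_num) hvolA.ne)
        · gcongr
    _ = (CD * (5 * L) ^ (2 - 2 * ρ)) ^ (2 / 3 : ℝ) * (volume A).toReal ^ (1 / 3 : ℝ) := by
        rw [ENNReal.toReal_mul, ← ENNReal.toReal_rpow, ← ENNReal.toReal_rpow, ENNReal.toReal_mul,
          ENNReal.toReal_ofReal (by positivity), ENNReal.toReal_ofReal hCD, mul_comm ((5 * L) ^ (2 - 2 * ρ)) CD]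

/-! ### The class average bound -/

/-- Exponent bookkeeping: `(C_D (5L)^{2−2ρ})^{2/3} (C_P L^{−1−2ρ})^{1/3} = C_D^{2/3} 5^{(4−4ρ)/3} C_P^{1/3} · L^{1−2ρ}`. [folklore] -/
theorem average_bookkeeping {CD CP L ρ : ℝ} (hCD : 0 ≤ CD) (hCP : 0 ≤ CP) (hL : 0 < L) :
    (CD * (5 * L) ^ (2 - 2 * ρ)) ^ (2 / 3 : ℝ) * (CP * L ^ (-1 - 2 * ρ)) ^ (1 / 3 : ℝ) =
      CD ^ (2 / 3 : ℝ) * (5 : ℝ) ^ ((2 - 2 * ρ) * (2 / 3)) * CP ^ (1 / 3 : ℝ) * L ^ (1 - 2 * ρ) := by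
  rw [Real.mul_rpow hCD (by positivity), Real.mul_rpow hCP (by positivity), Real.mul_rpow (by norm_num) hL.le,
    Real.mul_rpow (by positivity) (by positivity), ← Real.rpow_mul (by norm_num : (0 : ℝ) ≤ 5),
    ← Real.rpow_mul hL.le, ← Real.rpow_mul hL.le]
  have e : L ^ ((2 - 2 * ρ) * (2 / 3 : ℝ)) * L ^ ((-1 - 2 * ρ) * (1 / 3 : ℝ)) = L ^ (1 - 2 * ρ) := by
    rw [← Real.rpow_add hL]
    ring_nf
  calc CD ^ (2 / 3 : ℝ) * ((5 : ℝ) ^ ((2 - 2 * ρ) * (2 / 3)) * L ^ ((2 - 2 * ρ) * (2 / 3 : ℝ))) *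
        (CP ^ (1 / 3 : ℝ) * L ^ ((-1 - 2 * ρ) * (1 / 3 : ℝ)))
      = CD ^ (2 / 3 : ℝ) * (5 : ℝ) ^ ((2 - 2 * ρ) * (2 / 3)) * CP ^ (1 / 3 : ℝ) *
          (L ^ ((2 - 2 * ρ) * (2 / 3 : ℝ)) * L ^ ((-1 - 2 * ρ) * (1 / 3 : ℝ))) := by ring
    _ = CD ^ (2 / 3 : ℝ) * (5 : ℝ) ^ ((2 - 2 * ρ) * (2 / 3)) * CP ^ (1 / 3 : ℝ) * L ^ (1 - 2 * ρ) := by rw [e]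

/-- **THE CLASS AVERAGE BOUND.**  Let `(V, P′)` be a self-similar Euler profile on `ℝ³` (any `γ`, any centre) whose classical pressure
carries the weighted `D`-datum `∫ |P′|^{3/2} ‖y‖^{2ρ−2} ≤ C_D` (`ρ < 1`), and let `κ > 0`.  Then there are `C ≥ 0` and `L₁ ≥ 1` with
`∫ χ_R(y) P′(x₀ + y) dy ≤ κL² + C L^{1−2ρ}/R³` for all `L ≥ L₁`, `‖x₀‖ ≤ L`, `0 < R ≤ L`: the level-`κL²` average bound
(`integral_probeBump_mul_comp_add_le`), the PRIOR Chebyshev thinness `vol({κL² < P′} ∩ B_{5L}) ≤ C_P L^{−1−2ρ}`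
(`Loc.volume_pressureHigh_inter_ball_le_prior`, growth-free, `D`-datum only) and Hölder against the weight (`setIntegral_le_of_weight`).
[folklore] -/
theorem integral_probeBump_pressure_le {ρ γ : ℝ} {c : EuclideanSpace ℝ (Fin 3)}
    {V : EuclideanSpace ℝ (Fin 3) → EuclideanSpace ℝ (Fin 3)} {P' : EuclideanSpace ℝ (Fin 3) → ℝ}
    (hprof : IsSelfSimilarEulerProfile γ c V P') (hρ1 : ρ < 1) {CD : ℝ} (hCD : 0 ≤ CD)
    (hD : ∫⁻ y, ‖P' y‖ₑ ^ (3 / 2 : ℝ) * ENNReal.ofReal (‖y‖ ^ (2 * ρ - 2)) ≤ ENNReal.ofReal CD) {κ : ℝ} (hκ : 0 < κ) :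
    ∃ C L₁ : ℝ, 0 ≤ C ∧ 1 ≤ L₁ ∧ ∀ L : ℝ, L₁ ≤ L → ∀ x₀ : EuclideanSpace ℝ (Fin 3), ‖x₀‖ ≤ L →
      ∀ R : ℝ, 0 < R → R ≤ L →
        ∫ y, probeBump R y * P' (x₀ + y) ≤ κ * L ^ 2 + C * L ^ (1 - 2 * ρ) / R ^ 3 := by
  have hm : 0 < baseBumpMass (EuclideanSpace ℝ (Fin 3)) := baseBumpMass_pos
  have hPc : Continuous P' := hprof.contDiff_pressure.continuous
  obtain ⟨CP, L₁, hCP, hL₁, hprior⟩ :=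
    Loc.volume_pressureHigh_inter_ball_le_prior hρ1 hPc.aestronglyMeasurable hD hPc (c₀ := 0)
      (Eventually.of_forall fun y => by simp) hκ
  set C₀ : ℝ := CD ^ (2 / 3 : ℝ) * (5 : ℝ) ^ ((2 - 2 * ρ) * (2 / 3)) * CP ^ (1 / 3 : ℝ) with hC₀
  have hC₀0 : 0 ≤ C₀ := by positivity
  refine ⟨C₀ / baseBumpMass (EuclideanSpace ℝ (Fin 3)), L₁, by positivity, hL₁, fun L hL x₀ hx₀ R hR hRL => ?_⟩
  have hL0 : 0 < L := one_pos.trans_le (hL₁.trans hL)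
  have hκL : 0 ≤ κ * L ^ 2 := by positivity
  -- the level-`κL²` average bound
  have havg := integral_probeBump_mul_comp_add_le hPc hR hκL x₀
  -- the pressurised piece of `B_{2R}(x₀)` lies in `{κL² < P′} ∩ B_{5L}`
  set A : Set (EuclideanSpace ℝ (Fin 3)) := ball x₀ (2 * R) ∩ {z | κ * L ^ 2 < P' z} with hAdef
  have hAm : MeasurableSet A := measurableSet_ball.inter (isOpen_lt continuous_const hPc).measurableSet
  have hA5 : A ⊆ ball (0 : EuclideanSpace ℝ (Fin 3)) (5 * L) := fun z hz => by
    rw [mem_ball_zero_iff]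
    have h1 : ‖z - x₀‖ < 2 * R := by rw [← dist_eq_norm]; exact hz.1
    calc ‖z‖ = ‖(z - x₀) + x₀‖ := by rw [sub_add_cancel]
      _ ≤ ‖z - x₀‖ + ‖x₀‖ := norm_add_le _ _
      _ < 2 * R + L := add_lt_add_of_lt_of_le h1 hx₀
      _ ≤ 5 * L := by linarith
  have hAsub : A ⊆ {y : EuclideanSpace ℝ (Fin 3) | κ * L ^ 2 < P' y} ∩ ball (0 : EuclideanSpace ℝ (Fin 3)) (5 * L) :=
    fun z hz => ⟨hz.2, hA5 hz⟩
  have hvolA : (volume A).toReal ≤ CP * L ^ (-1 - 2 * ρ) :=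
    ENNReal.toReal_le_of_le_ofReal (by positivity) ((measure_mono hAsub).trans (hprior L hL))
  -- Hölder against the weight
  have hHol := setIntegral_le_of_weight hPc hρ1 hCD hD hAm hL0 hA5 (fun z hz => hκL.trans hz.2.le)
  have hbound : ∫ z in A, P' z ≤ C₀ * L ^ (1 - 2 * ρ) := by
    calc ∫ z in A, P' z ≤ (CD * (5 * L) ^ (2 - 2 * ρ)) ^ (2 / 3 : ℝ) * (volume A).toReal ^ (1 / 3 : ℝ) := hHol
      _ ≤ (CD * (5 * L) ^ (2 - 2 * ρ)) ^ (2 / 3 : ℝ) * (CP * L ^ (-1 - 2 * ρ)) ^ (1 / 3 : ℝ) := by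
          gcongr
      _ = C₀ * L ^ (1 - 2 * ρ) := by rw [average_bookkeeping hCD hCP hL0, hC₀]
  have hR3 : 0 < R ^ 3 := by positivity
  calc ∫ y, probeBump R y * P' (x₀ + y)
      ≤ κ * L ^ 2 + (baseBumpMass (EuclideanSpace ℝ (Fin 3)) * R ^ 3)⁻¹ * ∫ z in A, P' z := havg
    _ ≤ κ * L ^ 2 + (baseBumpMass (EuclideanSpace ℝ (Fin 3)) * R ^ 3)⁻¹ * (C₀ * L ^ (1 - 2 * ρ)) := by
        gcongr
    _ = κ * L ^ 2 + C₀ / baseBumpMass (EuclideanSpace ℝ (Fin 3)) * L ^ (1 - 2 * ρ) / R ^ 3 := by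
        field_simp

/-! ### The portrait theorem: far pressurised points sit next to gradient spikes -/

/-- **«FAR PRESSURISED POINTS OF A CLASS PROFILE SIT NEXT TO GRADIENT SPIKES»** (RESIDUE-MEMO-19832-g12 §4 (A2), at the point level).
Let `(V, P′)` be a `C²` self-similar Euler profile on `ℝ³` (any `γ`, any centre) with the class data `∫_{B_L(0)}‖DV‖² ≤ c_E L^{1−ρ}`
(all `L > 0`) and `∫ |P′|^{3/2}‖y‖^{2ρ−2} ≤ C_D`, `0 ≤ ρ < 1`, and let `κ > 0`.  Put `δ_L := (12 c_E (3L)^{1−ρ} + 1)/(m κ L²)`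
(`≍ c_E L^{−1−ρ}/κ`).  Then there is `L₁` such that for every `L ≥ L₁` and every `x₀ ∈ B̄_L(0)` with `P′(x₀) ≥ 3κL²` some point `z`
with `‖z − x₀‖ ≤ 2δ_L` has `‖DV(z)‖² ≥ m κ L²/(48 v₁ δ_L²)` (`≍ κ³ L^{4+2ρ}/c_E²`): the average at scale `R = L` is `≤ 2κL²`
(`integral_probeBump_pressure_le`), so the excess is `≥ κL²`, and `PressureParking.exists_gradient_spike_near_pressure_excess` applies
at the admissible scale `δ_L`. [folklore; GilbargTrudinger2001 Thm 2.1] -/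
theorem exists_gradient_spike_near_pressurised_point {ρ γ : ℝ} {c : EuclideanSpace ℝ (Fin 3)}
    {V : EuclideanSpace ℝ (Fin 3) → EuclideanSpace ℝ (Fin 3)} {P' : EuclideanSpace ℝ (Fin 3) → ℝ}
    (hprof : IsSelfSimilarEulerProfile γ c V P') (hρ0 : 0 ≤ ρ) (hρ1 : ρ < 1) {cE CD : ℝ} (hcE : 0 ≤ cE) (hCD : 0 ≤ CD)
    (hE : ∀ L : ℝ, 0 < L → ∫⁻ y in ball (0 : EuclideanSpace ℝ (Fin 3)) L, ‖fderiv ℝ V y‖ₑ ^ 2 ≤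
      ENNReal.ofReal (cE * L ^ (1 - ρ)))
    (hD : ∫⁻ y, ‖P' y‖ₑ ^ (3 / 2 : ℝ) * ENNReal.ofReal (‖y‖ ^ (2 * ρ - 2)) ≤ ENNReal.ofReal CD) {κ : ℝ} (hκ : 0 < κ) :
    ∃ L₁ : ℝ, 1 ≤ L₁ ∧ ∀ L : ℝ, L₁ ≤ L → ∀ x₀ : EuclideanSpace ℝ (Fin 3), ‖x₀‖ ≤ L → 3 * κ * L ^ 2 ≤ P' x₀ →
      ∃ z : EuclideanSpace ℝ (Fin 3),
        ‖z - x₀‖ ≤ 2 * ((12 * cE * (3 * L) ^ (1 - ρ) + 1) / (baseBumpMass (EuclideanSpace ℝ (Fin 3)) * κ * L ^ 2)) ∧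
        baseBumpMass (EuclideanSpace ℝ (Fin 3)) * κ * L ^ 2 /
            (48 * (volume (ball (0 : EuclideanSpace ℝ (Fin 3)) 1)).toReal *
              ((12 * cE * (3 * L) ^ (1 - ρ) + 1) / (baseBumpMass (EuclideanSpace ℝ (Fin 3)) * κ * L ^ 2)) ^ 2) ≤
          ‖fderiv ℝ V z‖ ^ 2 := by
  set m : ℝ := baseBumpMass (EuclideanSpace ℝ (Fin 3)) with hmdef
  have hm : 0 < m := baseBumpMass_pos
  obtain ⟨C, L₁, hC, hL₁, havg⟩ := integral_probeBump_pressure_le hprof hρ1 hCD hD hκ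
  -- thresholds: `C L^{1-2ρ}/L³ ≤ κ L²` and `δ_L ≤ L`
  set L₂ : ℝ := max L₁ (max (C / κ + 1) ((36 * cE + 1) / (m * κ) + 1)) with hL₂
  refine ⟨L₂, hL₁.trans (le_max_left _ _), fun L hL x₀ hx₀ hP => ?_⟩
  have hLL₁ : L₁ ≤ L := (le_max_left _ _).trans hL
  have hL1 : 1 ≤ L := hL₁.trans hLL₁
  have hL0 : 0 < L := one_pos.trans_le hL1
  have hLC : C / κ + 1 ≤ L := ((le_max_left _ _).trans (le_max_right _ _)).trans hL
  have hLE : (36 * cE + 1) / (m * κ) + 1 ≤ L := ((le_max_right _ _).trans (le_max_right _ _)).trans hL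
  set δ : ℝ := (12 * cE * (3 * L) ^ (1 - ρ) + 1) / (m * κ * L ^ 2) with hδdef
  have hδ : 0 < δ := by positivity
  -- `(3L)^{1-ρ} ≤ 3L` and `L^{1-2ρ} ≤ L` for `L ≥ 1`, `0 ≤ ρ`
  have h3L : (3 * L) ^ (1 - ρ) ≤ 3 * L := by
    have h1 : (1 : ℝ) ≤ 3 * L := by linarith
    calc (3 * L) ^ (1 - ρ) ≤ (3 * L) ^ (1 : ℝ) := Real.rpow_le_rpow_of_exponent_le h1 (by linarith)
      _ = 3 * L := Real.rpow_one _
  have hL12 : L ^ (1 - 2 * ρ) ≤ L := by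
    calc L ^ (1 - 2 * ρ) ≤ L ^ (1 : ℝ) := Real.rpow_le_rpow_of_exponent_le hL1 (by linarith)
      _ = L := Real.rpow_one _
  -- `δ ≤ L`
  have hmk : 0 < m * κ := mul_pos hm hκ
  have hδL : δ ≤ L := by
    rw [hδdef, div_le_iff₀ (by positivity)]
    have h1 : 12 * cE * (3 * L) ^ (1 - ρ) + 1 ≤ (36 * cE + 1) * L := by nlinarith
    have h2 : 36 * cE + 1 ≤ m * κ * (L - 1) := by
      have h' : (36 * cE + 1) / (m * κ) ≤ L - 1 := by linarith
      rw [div_le_iff₀ hmk] at h'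
      linarith
    have h3 : (36 * cE + 1) * L ≤ m * κ * (L - 1) * L := mul_le_mul_of_nonneg_right h2 hL0.le
    have h4 : m * κ * (L - 1) * L ≤ L * (m * κ * L ^ 2) := by
      have : (L - 1) * L ≤ L * L ^ 2 := by nlinarith
      nlinarith [hmk]
    linarith
  -- the average at scale `R = L` is `≤ 2κL²`
  have havgL := havg L hLL₁ x₀ hx₀ L hL0 le_rfl
  have hCL : C * L ^ (1 - 2 * ρ) / L ^ 3 ≤ κ * L ^ 2 := by
    rw [div_le_iff₀ (by positivity)]
    have h1 : C * L ^ (1 - 2 * ρ) ≤ C * L := mul_le_mul_of_nonneg_left hL12 hC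
    have h2 : C ≤ κ * (L - 1) := by
      have h' : C / κ ≤ L - 1 := by linarith
      rw [div_le_iff₀ hκ] at h'
      linarith
    have h3 : C * L ≤ κ * (L - 1) * L := mul_le_mul_of_nonneg_right h2 hL0.le
    have h4 : κ * (L - 1) * L ≤ κ * L ^ 2 * L ^ 3 := by
      have : (L - 1) * L ≤ L ^ 2 * L ^ 3 := by nlinarith [pow_le_pow_right₀ hL1 (show 1 ≤ 4 by norm_num)]
      nlinarith [hκ]
    linarith
  have hexcess : κ * L ^ 2 + ∫ y, probeBump L y * P' (x₀ + y) ≤ P' x₀ := by linarith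
  -- admissibility of `δ`
  have hδbig : 12 * cE * (3 * L) ^ (1 - ρ) ≤ m * κ * L ^ 2 * δ := by
    have e : m * κ * L ^ 2 * δ = 12 * cE * (3 * L) ^ (1 - ρ) + 1 := by
      rw [hδdef]
      field_simp
    linarith
  obtain ⟨z, hz, hspike⟩ := exists_gradient_spike_near_pressure_excess hprof hcE hE hL1 le_rfl hδ hδL hx₀ hexcess hδbig
  refine ⟨z, ?_, hspike⟩
  rw [mem_closedBall, dist_eq_norm] at hz
  exact hz

end Summit.NavierStokesRegularity.NavierStokesRegularity.Theorems.PowerGaugeEulerLiouville.PressureParking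

end
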